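import Literature.NumberTheory.Transcendental.Hyperlogarithms
import HarnessLib

/-!
# Hyperlogarithms on `(0,1)`, III: the power-series expansion at the base point

Third layer of the analytic road to `GenusZeroPeriodsMZV` (see `Hyperlogarithms.lean`): the
hyperlogarithms `L_w(b)` (`Hyperlog.hlog`, positive normalisation, real alphabet `{0} ∪ [1,∞)`,
`w` regular at `0`) are given on `(0,1)` by a convergent POWER SERIES with NONNEGATIVE coefficients,
`L_w(b) = Σ_m a_m(w) b^m` — Brown's explicit formula [Brown 2009, (5.3)] (due to Poincaré and
Lappo-Danilevsky) "which converges absolutely for `|z - σ₀| < inf{|σ_{i} - σ₀|}`", for the alphabet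
`{0,1}` the multiple polylogarithm series [Brown 2009, (5.13)]. We take the coefficients in the
RECURSIVE form forced by the integral formula (5.4) (`Hyperlog.coeff`: `a_{m+1}(zw) = a_{m+1}(w)/(m+1)`
for the letter at `0`, `a_{m+1}(cw) = (Σ_{j+k=m} σ_c^{-(j+1)} a_k(w))/(m+1)` for `σ_c ≥ 1`) and PROVE
the expansion (`hasSum_coeff`) by induction on the word: the integrand of (5.4) expands pointwise
(shift for `dt/t`; Cauchy product with the geometric series `1/(σ_c - t) = Σ t^j/σ_c^{j+1}` for the
other letters), and the termwise integration is Tonelli's theorem in `ℝ≥0∞`, finiteness coming from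
the absolutely convergent integral (5.4) (`Hyperlog.hlog_cons`). Consequences: `a_m(w) ≥ 0`
(`coeff_nonneg`), and the Taylor remainder estimate at `0`
`0 ≤ L_w(b) - Σ_{m≤M} a_m(w) b^m ≤ (b/b₀)^{M+1} L_w(b₀)` (`hlog_sub_sum_le`), i.e. the analytic
structure of `L_w` at the tangential base point needed for regularised values. Everything is PROVED;
no named fact is introduced.

## References

* F. C. S. Brown, *Multiple zeta values and periods of moduli spaces `𝔐̄_{0,n}`*, Ann. Sci. Éc.
  Norm. Supér. (4) 42 (2009), 371–489, §5.1 (p. 439: (5.3), (5.4)), §5.5 (p. 444: (5.13)).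
  doi:10.24033/asens.2099. [BrownENS2009]
-/

noncomputable section

open MeasureTheory intervalIntegral Set Filter
open scoped BigOperators Topology

namespace Literature.NumberTheory.Transcendental

namespace Hyperlog

variable {α : Type*} (σ : α → ℝ)

/-! ### Power-series expansion at the base point (Brown's formula (5.3), positive normalisation) -/

section PowerSeries

open Finset in
/-- **Taylor coefficients at `0`** of the positive hyperlogarithms, defined by the recursion read off
from (5.4): `a_m(∅) = δ_{m,0}`; `a_0(cw) = 0`; for the letter at `0`, `a_{m+1}(zw) = a_{m+1}(w)/(m+1)`
(`∫_0^b t^m = b^{m+1}/(m+1)`); for a letter `σ_c = s ≥ 1`, `a_{m+1}(cw) = (Σ_{j+k=m} s^{-(j+1)} a_k(w))/(m+1)`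
(`1/(s-t) = Σ_j t^j/s^{j+1}`). For the alphabet `{0,1}` these are the coefficients of the multiple
polylogarithm `Li_w` [Brown 2009, (5.13)]; in general, of [Brown 2009, (5.3)] (up to the sign
normalisation). [cite: BrownENS2009, §5.1 eq. (5.3)] -/
def coeff (σ : α → ℝ) : List α → ℕ → ℝ
  | [], m => if m = 0 then 1 else 0
  | _ :: _, 0 => 0
  | c :: w, m + 1 =>
    if σ c = 0 then coeff σ w (m + 1) / (m + 1)
    else (∑ jk ∈ antidiagonal m, (1 / σ c ^ (jk.1 + 1)) * coeff σ w jk.2) / (m + 1)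

variable {σ}

/-- `a_0(∅) = 1`, `a_{m+1}(∅) = 0`. [folklore] -/
theorem coeff_nil (m : ℕ) : coeff σ [] m = if m = 0 then 1 else 0 := by
  cases m <;> simp [coeff]

/-- `a_0(cw) = 0`. [folklore] -/
@[simp] theorem coeff_cons_zero (c : α) (w : List α) : coeff σ (c :: w) 0 = 0 := rfl

/-- The recursion for the letter at `0`. [folklore] -/
theorem coeff_cons_succ_of_eq_zero {c : α} (hc : σ c = 0) (w : List α) (m : ℕ) :
    coeff σ (c :: w) (m + 1) = coeff σ w (m + 1) / (m + 1) := by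
  simp [coeff, hc]

open Finset in
/-- The recursion for a letter in `[1,∞)`. [folklore] -/
theorem coeff_cons_succ_of_ne_zero {c : α} (hc : σ c ≠ 0) (w : List α) (m : ℕ) :
    coeff σ (c :: w) (m + 1) =
      (∑ jk ∈ antidiagonal m, (1 / σ c ^ (jk.1 + 1)) * coeff σ w jk.2) / (m + 1) := by
  simp [coeff, hc]

/-- `a_0(w) = 0` for a nonempty word. [folklore] -/
theorem coeff_zero_of_ne_nil {w : List α} (hw : w ≠ []) : coeff σ w 0 = 0 := by
  cases w with
  | nil => exact absurd rfl hw
  | cons c w => rfl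

variable (hσ : ∀ c, σ c = 0 ∨ 1 ≤ σ c)
include hσ

/-- **All Taylor coefficients are nonnegative** (positive normalisation). [folklore] -/
theorem coeff_nonneg : ∀ (w : List α) (m : ℕ), 0 ≤ coeff σ w m
  | [], m => by rw [coeff_nil]; split_ifs <;> norm_num
  | c :: w, 0 => le_rfl
  | c :: w, m + 1 => by
    by_cases hc : σ c = 0
    · rw [coeff_cons_succ_of_eq_zero hc]
      exact div_nonneg (coeff_nonneg w (m + 1)) (by positivity)
    · rw [coeff_cons_succ_of_ne_zero hc]
      have h1 : 1 ≤ σ c := (hσ c).resolve_left hc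
      refine div_nonneg (Finset.sum_nonneg fun jk _ => mul_nonneg ?_ (coeff_nonneg w jk.2)) (by positivity)
      have : 0 < σ c := by linarith
      positivity

omit hσ in
/-- Pointwise expansion of the integrand of (5.4), letter at `0`:
`L_w(t)/t = Σ_m a_{m+1}(w) t^m = Σ_m (m+1) a_{m+1}(zw) t^m`. [folklore] -/
theorem hasSum_integrand_of_eq_zero {c : α} (hc : σ c = 0) {w : List α} (hw : w ≠ []) {t : ℝ}
    (ht : 0 < t) (IH : HasSum (fun k => coeff σ w k * t ^ k) (hlog σ w t)) :
    HasSum (fun m : ℕ => ((m : ℝ) + 1) * coeff σ (c :: w) (m + 1) * t ^ m) (pden σ c t * hlog σ w t) := by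
  have h1 : HasSum (fun m => coeff σ w (m + 1) * t ^ (m + 1)) (hlog σ w t) := by
    have := (hasSum_nat_add_iff (f := fun k => coeff σ w k * t ^ k) 1 (g := hlog σ w t)).2
    simp only [Finset.range_one, Finset.sum_singleton, pow_zero, mul_one,
      coeff_zero_of_ne_nil hw, add_zero] at this
    exact this IH
  have h2 := h1.mul_left t⁻¹
  have hf : (fun m : ℕ => ((m : ℝ) + 1) * coeff σ (c :: w) (m + 1) * t ^ m) =
      fun m : ℕ => t⁻¹ * (coeff σ w (m + 1) * t ^ (m + 1)) := by
    funext m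
    rw [coeff_cons_succ_of_eq_zero hc, pow_succ]
    field_simp
  rw [hf, pden_of_eq_zero hc ht, one_div]
  exact h2

open Finset in
/-- Pointwise expansion of the integrand of (5.4), letter `σ_c = s ≥ 1`:
`L_w(t)/(s-t) = (Σ_j t^j/s^{j+1})(Σ_k a_k(w) t^k) = Σ_m (m+1) a_{m+1}(cw) t^m` (Cauchy product of two
series with nonnegative terms). [folklore] -/
theorem hasSum_integrand_of_ne_zero {c : α} (hc : σ c ≠ 0) (w : List α) {t : ℝ}
    (ht : t ∈ Ioo (0 : ℝ) 1) (IH : HasSum (fun k => coeff σ w k * t ^ k) (hlog σ w t)) :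
    HasSum (fun m : ℕ => ((m : ℝ) + 1) * coeff σ (c :: w) (m + 1) * t ^ m) (pden σ c t * hlog σ w t) := by
  have h1 : 1 ≤ σ c := (hσ c).resolve_left hc
  have hs : 0 < σ c := by linarith
  -- the geometric series `1/(s-t) = Σ_j t^j/s^{j+1}`
  have hr0 : 0 ≤ t / σ c := div_nonneg ht.1.le hs.le
  have hr1 : t / σ c < 1 := by rw [div_lt_one hs]; linarith [ht.2]
  have hs0 : σ c ≠ 0 := hs.ne'
  have hst : σ c - t ≠ 0 := by linarith [ht.2]
  have hgeo : HasSum (fun j : ℕ => (1 / σ c ^ (j + 1)) * t ^ j) (pden σ c t) := by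
    have h := (hasSum_geometric_of_lt_one hr0 hr1).mul_left (1 / σ c)
    have hf : (fun i : ℕ => 1 / σ c * (t / σ c) ^ i) = fun j : ℕ => (1 / σ c ^ (j + 1)) * t ^ j := by
      funext j; rw [div_pow, pow_succ]; field_simp
    have hv : 1 / σ c * (1 - t / σ c)⁻¹ = pden σ c t := by
      rw [pden_of_ne_zero hσ hc ht.2]
      have h1t : 1 - t / σ c ≠ 0 := by
        rw [sub_ne_zero, ne_comm, ne_eq, div_eq_one_iff_eq hs0]
        linarith [ht.2]
      field_simp
    rw [hf, hv] at h
    exact h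
  have hf0 : 0 ≤ fun j : ℕ => (1 / σ c ^ (j + 1)) * t ^ j := fun j => by
    have := ht.1.le; positivity
  have hg0 : 0 ≤ fun k : ℕ => coeff σ w k * t ^ k := fun k =>
    mul_nonneg (coeff_nonneg hσ w k) (pow_nonneg ht.1.le _)
  have hprod : Summable fun x : ℕ × ℕ => (1 / σ c ^ (x.1 + 1) * t ^ x.1) * (coeff σ w x.2 * t ^ x.2) :=
    hgeo.summable.mul_of_nonneg IH.summable hf0 hg0
  have hcauchy := hgeo.summable.tsum_mul_tsum_eq_tsum_sum_antidiagonal IH.summable hprod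
  rw [hgeo.tsum_eq, IH.tsum_eq] at hcauchy
  have hsum := (summable_sum_mul_antidiagonal_of_summable_mul
    (f := fun j : ℕ => 1 / σ c ^ (j + 1) * t ^ j) (g := fun k : ℕ => coeff σ w k * t ^ k) hprod).hasSum
  rw [← hcauchy] at hsum
  have hfun : (fun m : ℕ => ∑ kl ∈ antidiagonal m,
      (1 / σ c ^ (kl.1 + 1) * t ^ kl.1) * (coeff σ w kl.2 * t ^ kl.2)) =
      fun m : ℕ => ((m : ℝ) + 1) * coeff σ (c :: w) (m + 1) * t ^ m := by
    funext m
    rw [coeff_cons_succ_of_ne_zero hc, Finset.sum_div, Finset.mul_sum, Finset.sum_mul]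
    refine Finset.sum_congr rfl fun jk hjk => ?_
    rw [Finset.HasAntidiagonal.mem_antidiagonal] at hjk
    rw [← hjk, pow_add]
    push_cast
    field_simp
    ring
  rw [hfun] at hsum
  exact hsum

/-- **The power-series expansion at the base point**: for a word `w` regular at `0` and
`b ∈ (0,1)`, `L_w(b) = Σ_{m ≥ 0} a_m(w) b^m` (a convergent series of nonnegative terms) — Brown's
explicit formula (5.3) "which converges absolutely for `|z - σ₀| < inf |σ_i - σ₀|`" in the recursive
form forced by (5.4). [cite: BrownENS2009, §5.1 eq. (5.3)] -/
theorem hasSum_coeff : ∀ {w : List α}, IsReg σ w → ∀ {b : ℝ}, b ∈ Ioo (0 : ℝ) 1 →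
    HasSum (fun m => coeff σ w m * b ^ m) (hlog σ w b)
  | [], _, b, hb => by
    rw [hlog_nil hσ hb]
    have h : HasSum (fun m : ℕ => if m = 0 then (1 : ℝ) else 0) 1 := by
      simpa using hasSum_single (f := fun m : ℕ => if m = 0 then (1 : ℝ) else 0) 0
        (fun m hm => if_neg hm)
    convert h using 1
    funext m
    rw [coeff_nil]
    split_ifs with hm
    · rw [hm, pow_zero, mul_one]
    · rw [zero_mul]
  | c :: w, hw, b, hb => by
    have hw' : IsReg σ w := hw.tail σ
    have IH : ∀ {t : ℝ}, t ∈ Ioo (0 : ℝ) 1 → HasSum (fun k => coeff σ w k * t ^ k) (hlog σ w t) :=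
      fun ht => hasSum_coeff hw' ht
    -- the termwise integrands `F m t = (m+1) a_{m+1}(cw) t^m ≥ 0`
    have hpt : ∀ t ∈ Ioo (0 : ℝ) b, HasSum (fun m : ℕ => ((m : ℝ) + 1) * coeff σ (c :: w) (m + 1) * t ^ m)
        (pden σ c t * hlog σ w t) := by
      intro t ht
      have ht' : t ∈ Ioo (0 : ℝ) 1 := ⟨ht.1, ht.2.trans hb.2⟩
      by_cases hc : σ c = 0
      · have hwne : w ≠ [] := by
          intro h; subst h
          exact (isReg_singleton σ).1 hw hc
        exact hasSum_integrand_of_eq_zero hc hwne ht'.1 (IH ht')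
      · exact hasSum_integrand_of_ne_zero hσ hc w ht' (IH ht')
    have hF0 : ∀ t ∈ Ioo (0 : ℝ) b, ∀ m : ℕ, 0 ≤ ((m : ℝ) + 1) * coeff σ (c :: w) (m + 1) * t ^ m :=
      fun t ht m => mul_nonneg (mul_nonneg (by positivity) (coeff_nonneg hσ _ _)) (pow_nonneg ht.1.le _)
    -- termwise integrals
    have hlin : ∀ m : ℕ, ∫⁻ t in Ioo 0 b, ENNReal.ofReal (((m : ℝ) + 1) * coeff σ (c :: w) (m + 1) * t ^ m)
        = ENNReal.ofReal (coeff σ (c :: w) (m + 1) * b ^ (m + 1)) := by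
      intro m
      have hsplit : ∀ t : ℝ, ENNReal.ofReal (((m : ℝ) + 1) * coeff σ (c :: w) (m + 1) * t ^ m) =
          ENNReal.ofReal (((m : ℝ) + 1) * coeff σ (c :: w) (m + 1)) * ENNReal.ofReal (t ^ m) :=
        fun t => ENNReal.ofReal_mul (mul_nonneg (by positivity) (coeff_nonneg hσ _ _))
      simp_rw [hsplit]
      rw [lintegral_const_mul _ (KZ.MZVSimplex.measurable_ofReal_pow m),
        KZ.MZVSimplex.lintegral_pow_Ioo m hb.1.le,
        ← ENNReal.ofReal_mul (mul_nonneg (by positivity) (coeff_nonneg hσ _ _))]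
      congr 1
      field_simp
    -- Tonelli
    have hton : ∫⁻ t in Ioo 0 b, ENNReal.ofReal (pden σ c t * hlog σ w t) =
        ∑' m : ℕ, ENNReal.ofReal (coeff σ (c :: w) (m + 1) * b ^ (m + 1)) := by
      calc ∫⁻ t in Ioo 0 b, ENNReal.ofReal (pden σ c t * hlog σ w t)
          = ∫⁻ t in Ioo 0 b, ∑' m : ℕ,
              ENNReal.ofReal (((m : ℝ) + 1) * coeff σ (c :: w) (m + 1) * t ^ m) := by
            refine setLIntegral_congr_fun measurableSet_Ioo fun t ht => ?_
            rw [← (hpt t ht).tsum_eq, ENNReal.ofReal_tsum_of_nonneg (hF0 t ht) (hpt t ht).summable]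
        _ = ∑' m : ℕ, ∫⁻ t in Ioo 0 b,
              ENNReal.ofReal (((m : ℝ) + 1) * coeff σ (c :: w) (m + 1) * t ^ m) :=
            lintegral_tsum fun m => (ENNReal.measurable_ofReal.comp
              (measurable_const.mul (measurable_id.pow_const m))).aemeasurable
        _ = _ := tsum_congr hlin
    -- the left-hand side is the (finite) integral (5.4)
    have hint := intervalIntegrable_pden_mul_hlog hσ hw hb
    have hnn : 0 ≤ᵐ[volume.restrict (Ioo 0 b)] fun t => pden σ c t * hlog σ w t :=
      (ae_restrict_iff' measurableSet_Ioo).2 (ae_of_all _ fun t ht =>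
        mul_nonneg (pden_nonneg c t ⟨ht.1, ht.2.trans hb.2⟩)
          (hlog_nonneg hσ hw' ⟨ht.1, ht.2.trans hb.2⟩))
    have hIoo : IntegrableOn (fun t => pden σ c t * hlog σ w t) (Ioo 0 b) volume :=
      (intervalIntegrable_iff_integrableOn_Ioo_of_le hb.1.le).1 hint
    have hval : hlog σ (c :: w) b = ∫ t in Ioo 0 b, pden σ c t * hlog σ w t := by
      rw [hlog_cons hσ hw hb, intervalIntegral.integral_of_le hb.1.le, integral_Ioc_eq_integral_Ioo]
    have hfin : ∑' m : ℕ, ENNReal.ofReal (coeff σ (c :: w) (m + 1) * b ^ (m + 1)) =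
        ENNReal.ofReal (hlog σ (c :: w) b) := by
      rw [← hton, hval, ofReal_integral_eq_lintegral_ofReal hIoo hnn]
    -- back to real numbers
    have hterm0 : ∀ m : ℕ, 0 ≤ coeff σ (c :: w) (m + 1) * b ^ (m + 1) := fun m =>
      mul_nonneg (coeff_nonneg hσ _ _) (pow_nonneg hb.1.le _)
    have hsum : Summable fun m : ℕ => coeff σ (c :: w) (m + 1) * b ^ (m + 1) := by
      have h := ENNReal.summable_toReal (f := fun m : ℕ =>
        ENNReal.ofReal (coeff σ (c :: w) (m + 1) * b ^ (m + 1))) (by rw [hfin]; exact ENNReal.ofReal_ne_top)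
      simpa only [ENNReal.toReal_ofReal (hterm0 _)] using h
    have htsum : ∑' m : ℕ, coeff σ (c :: w) (m + 1) * b ^ (m + 1) = hlog σ (c :: w) b := by
      have h := congrArg ENNReal.toReal hfin
      rw [ENNReal.tsum_toReal_eq (fun _ => ENNReal.ofReal_ne_top),
        ENNReal.toReal_ofReal (hlog_nonneg hσ hw hb)] at h
      simpa only [ENNReal.toReal_ofReal (hterm0 _)] using h
    have h1 : HasSum (fun m : ℕ => coeff σ (c :: w) (m + 1) * b ^ (m + 1)) (hlog σ (c :: w) b) := by
      rw [← htsum]; exact hsum.hasSum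
    have := (hasSum_nat_add_iff (f := fun m => coeff σ (c :: w) m * b ^ m) 1 (g := hlog σ (c :: w) b)).1
    simp only [Finset.range_one, Finset.sum_singleton, coeff_cons_zero, zero_mul, add_zero] at this
    exact this h1

/-- The expansion, summed: `L_w(b) = Σ' a_m(w) b^m`. [cite: BrownENS2009, §5.1 eq. (5.3)] -/
theorem hlog_eq_tsum_coeff {w : List α} (hw : IsReg σ w) {b : ℝ} (hb : b ∈ Ioo (0 : ℝ) 1) :
    hlog σ w b = ∑' m : ℕ, coeff σ w m * b ^ m :=
  (hasSum_coeff hσ hw hb).tsum_eq.symm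

/-- **Taylor remainder at `0`**: for `0 < b ≤ b₀ < 1`,
`0 ≤ L_w(b) - Σ_{m ≤ M} a_m(w) b^m ≤ (b/b₀)^{M+1} L_w(b₀)` — in particular
`L_w(b) = Σ_{m ≤ M} a_m(w) b^m + O(b^{M+1})` as `b → 0⁺`. [folklore] -/
theorem hlog_sub_sum_le {w : List α} (hw : IsReg σ w) (M : ℕ) {b b₀ : ℝ} (hb : 0 < b) (hbb₀ : b ≤ b₀)
    (hb₀ : b₀ < 1) :
    0 ≤ hlog σ w b - ∑ m ∈ Finset.range (M + 1), coeff σ w m * b ^ m ∧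
      hlog σ w b - ∑ m ∈ Finset.range (M + 1), coeff σ w m * b ^ m ≤
        (b / b₀) ^ (M + 1) * hlog σ w b₀ := by
  have hb' : b ∈ Ioo (0 : ℝ) 1 := ⟨hb, hbb₀.trans_lt hb₀⟩
  have hb₀' : b₀ ∈ Ioo (0 : ℝ) 1 := ⟨hb.trans_le hbb₀, hb₀⟩
  have hb₀0 : 0 < b₀ := hb.trans_le hbb₀
  have h := hasSum_coeff hσ hw hb'
  have h₀ := hasSum_coeff hσ hw hb₀'
  -- tails
  have ht := (hasSum_nat_add_iff' (f := fun m => coeff σ w m * b ^ m) (M + 1) (g := hlog σ w b)).2 h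
  have ht₀ := (hasSum_nat_add_iff' (f := fun m => coeff σ w m * b₀ ^ m) (M + 1) (g := hlog σ w b₀)).2 h₀
  have hc0 := coeff_nonneg hσ w
  constructor
  · rw [← ht.tsum_eq]
    exact tsum_nonneg fun m => mul_nonneg (hc0 _) (pow_nonneg hb.le _)
  · -- termwise: `a_{m+M+1} b^{m+M+1} ≤ (b/b₀)^{M+1} a_{m+M+1} b₀^{m+M+1}`
    have hle : ∀ m : ℕ, coeff σ w (m + (M + 1)) * b ^ (m + (M + 1)) ≤
        (b / b₀) ^ (M + 1) * (coeff σ w (m + (M + 1)) * b₀ ^ (m + (M + 1))) := by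
      intro m
      have hq : b ^ (m + (M + 1)) ≤ (b / b₀) ^ (M + 1) * b₀ ^ (m + (M + 1)) := by
        have hrw : (b / b₀) ^ (M + 1) * b₀ ^ (m + (M + 1)) = b₀ ^ m * b ^ (M + 1) := by
          rw [div_pow, pow_add]; field_simp; ring
        rw [hrw, pow_add]
        exact mul_le_mul_of_nonneg_right (pow_le_pow_left₀ hb.le hbb₀ m) (by positivity)
      calc coeff σ w (m + (M + 1)) * b ^ (m + (M + 1))
          ≤ coeff σ w (m + (M + 1)) * ((b / b₀) ^ (M + 1) * b₀ ^ (m + (M + 1))) :=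
            mul_le_mul_of_nonneg_left hq (hc0 _)
        _ = _ := by ring
    have hsub : hlog σ w b₀ - ∑ i ∈ Finset.range (M + 1), coeff σ w i * b₀ ^ i ≤ hlog σ w b₀ := by
      refine sub_le_self _ (Finset.sum_nonneg fun i _ => mul_nonneg (hc0 _) (pow_nonneg hb₀'.1.le _))
    calc hlog σ w b - ∑ m ∈ Finset.range (M + 1), coeff σ w m * b ^ m
        = ∑' m : ℕ, coeff σ w (m + (M + 1)) * b ^ (m + (M + 1)) := ht.tsum_eq.symm
      _ ≤ ∑' m : ℕ, (b / b₀) ^ (M + 1) * (coeff σ w (m + (M + 1)) * b₀ ^ (m + (M + 1))) :=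
          ht.summable.tsum_le_tsum hle (ht₀.summable.mul_left _)
      _ = (b / b₀) ^ (M + 1) * (hlog σ w b₀ - ∑ i ∈ Finset.range (M + 1), coeff σ w i * b₀ ^ i) := by
          rw [tsum_mul_left, ht₀.tsum_eq]
      _ ≤ (b / b₀) ^ (M + 1) * hlog σ w b₀ :=
          mul_le_mul_of_nonneg_left hsub (by positivity)

end PowerSeries

end Hyperlog

end Literature.NumberTheory.Transcendental
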